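import Summits.AtomisticToContinuum.BoseEinsteinCondensation.Theorems.BECThomsonPrincipleFibreRegularity
import HarnessLib

/-!
# Route `BECThomsonPrinciple`, crux `FibreConductance` (stmt-AtomisticToContinuum-9480),
# line `parseval-shell-bootstrap` — fibre infrastructure II: Fubini over the fibre

Fubini/Tonelli bookkeeping for the fibre objects of `BECThomsonPrincipleDefs` (companion of
`BECThomsonPrincipleFibreRegularity`), splitting off particle `0` of the torus
`(ℝ³/Lℤ³)^{m+1}` (`lintegral_cellN_succ`, `lintegral_cellN_lintegral_update`):

* `∫_{cell^N} W dX = L³` (`lintegral_cellN_fibreW`: `∫_{cell^m} W dX̂ = ∫_{cell^N}|Φ|² = 1`);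
* the fibre average `∫_{cell^N} G = L⁻³ ∫_{cell^N} ∫_cell G(X[0↦y]) dy dX`
  (`lintegral_cellN_eq_fibre_average`);
* the bath expectation of the fibre Fourier modes is an occupation number,
  `∫_{cell^N} W |ĉ_q(ψ(·|X̂))|² dX = n_q(|Φ|)/N` (`lintegral_fibreW_mul_norm_sq_cellFourierCoeff`,
  `n_q = cellOccupation` of the plane wave `planeWaveMode L q` in `X ↦ |Φ X|`, through
  `cellOccupation_succ` and `|Φ|(·, X̂) = √W(X̂) ψ(·|X̂)`).

Registered anchor (`--supports` the crux item): `lintegral_fibreW_mul_norm_sq_cellFourierCoeff`.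

References: the line card `Cruxes/FibreConductance/Lines/parseval-shell-bootstrap.md`; LSSY2005
§1.2 (1.17)–(1.18) (occupations).
-/

noncomputable section

namespace Summit.AtomisticToContinuum.BoseEinsteinCondensation.Cruxes.FibreConductance.ParsevalShellBootstrap

open MeasureTheory
open scoped ENNReal ComplexConjugate
open Literature.MathematicalPhysics.QuantumManyBody.BoseGas

variable {m : ℕ} {L : ℝ}

/-! ### Measurability and derivative conveniences -/

/-- `W` is measurable. [folklore] -/
theorem measurable_fibreW (Φ : PeriodicTrialState (m + 1) L) : Measurable (fibreW Φ) :=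
  (continuous_fibreW Φ).measurable

/-- `ψ` is measurable (zero-free state, `L > 0`). [folklore] -/
theorem measurable_fibrePsi (hL : 0 < L) (Φ : PeriodicTrialState (m + 1) L) (hΦ : ∀ X, Φ.ψ X ≠ 0) :
    Measurable (fibrePsi Φ) :=
  (continuous_fibrePsi hL Φ hΦ).measurable

/-- `β` is measurable (zero-free state, `L > 0`). [folklore] -/
theorem measurable_fibreBeta (hL : 0 < L) (n : Fin 3 → ℤ) (Φ : PeriodicTrialState (m + 1) L)
    (hΦ : ∀ X, Φ.ψ X ≠ 0) : Measurable (fibreBeta n Φ) :=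
  (continuous_fibreBeta hL n Φ hΦ).measurable

/-- `∂ψ/∂x_{0,l}` is continuous (zero-free state, `L > 0`). [folklore] -/
theorem continuous_dPsi (hL : 0 < L) (Φ : PeriodicTrialState (m + 1) L) (hΦ : ∀ X, Φ.ψ X ≠ 0)
    (l : Fin 3) : Continuous fun X => dPsi Φ X l :=
  ((contDiff_fibrePsi hL Φ hΦ).continuous_fderiv one_ne_zero).clm_apply continuous_const

/-- `∂ψ/∂x_{0,l}` is `Lℤ³`-periodic in every particle. [folklore] -/
theorem dPsi_periodic (Φ : PeriodicTrialState (m + 1) L) (X : Config (m + 1)) (i : Fin (m + 1))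
    (k : Fin 3) (l : Fin 3) : dPsi Φ (X + Pi.single i (EuclideanSpace.single k L)) l = dPsi Φ X l := by
  unfold dPsi
  have h : fibrePsi Φ = fun Y => fibrePsi Φ (Y + Pi.single i (EuclideanSpace.single k L)) :=
    funext fun Y => (fibrePsi_periodic Φ Y i k).symm
  conv_rhs => rw [h, fderiv_comp_add_right]

/-! ### Fubini over the fibre -/

/-- Total bath weight: `∫_{cell^N} W dX = L³` (`∫_{cell^m} W dX̂ = ∫_{cell^N}|Φ|² = 1`). [folklore] -/
theorem lintegral_cellN_fibreW (hL : 0 < L) (Φ : PeriodicTrialState (m + 1) L) :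
    ∫⁻ X in cellN (m + 1) L, ENNReal.ofReal (fibreW Φ X) = ENNReal.ofReal (L ^ 3) := by
  have h : ∀ X, ENNReal.ofReal (fibreW Φ X) =
      ∫⁻ y in cell L, (‖Φ.ψ (Function.update X 0 y)‖₊ : ℝ≥0∞) ^ 2 := by
    intro X
    have hc : Continuous fun y : Space => ‖Φ.ψ (Function.update X 0 y)‖ ^ 2 :=
      ((continuous_slice Φ X).norm).pow 2
    rw [fibreW, ofReal_integral_eq_lintegral_ofReal (integrableOn_cell hc)
      (Filter.Eventually.of_forall fun y => sq_nonneg _)]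
    simp_rw [coe_nnnorm_sq_eq_ofReal]
  simp_rw [h]
  rw [lintegral_normSq_slice 0 Φ.contDiff.continuous.measurable, Φ.norm_eq, mul_one,
    ENNReal.ofReal_pow hL.le]

/-- **Fibre Fubini for a fibre-constant weight**: for measurable `G ≥ 0`,
`∫_{cell^N} G dX = ∫_{cell^N} (L⁻³ ∫_cell G(X[0↦y]) dy) dX` — integrating a function over the fibre
and spreading the result uniformly costs the factor `L³ = |cell|`. [folklore] -/
theorem lintegral_cellN_eq_fibre_average (hL : 0 < L) {G : Config (m + 1) → ℝ≥0∞} (hG : Measurable G) :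
    ∫⁻ X in cellN (m + 1) L, G X =
      (ENNReal.ofReal (L ^ 3))⁻¹ * ∫⁻ X in cellN (m + 1) L, ∫⁻ y in cell L, G (Function.update X 0 y) := by
  rw [lintegral_cellN_lintegral_update 0 hG, ← mul_assoc, ENNReal.ofReal_pow hL.le,
    ENNReal.inv_mul_cancel (pow_ne_zero _ (by simpa using hL))
      (ENNReal.pow_ne_top ENNReal.ofReal_ne_top), one_mul]

/-- The cell Fourier coefficients are linear under constant multiples. [folklore] -/
theorem cellFourierCoeff_const_mul (hL : 0 < L) (c : ℂ) (f : Space → ℂ) (q : Fin 3 → ℤ) :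
    cellFourierCoeff L (fun x => c * f x) q = c * cellFourierCoeff L f q := by
  rw [cellFourierCoeff_eq_integral hL, cellFourierCoeff_eq_integral hL, Complex.real_smul,
    Complex.real_smul]
  have h : ∀ x, conj (cellWave L q x) * (c * f x) = c * (conj (cellWave L q x) * f x) :=
    fun x => by ring
  simp_rw [h, integral_const_mul]
  ring

/-- The fibre Fourier modes `X ↦ ĉ_q(ψ(·|X̂))` depend continuously on the configuration. [folklore] -/
theorem continuous_cellFourierCoeff_fibrePsi (hL : 0 < L) (Φ : PeriodicTrialState (m + 1) L)
    (hΦ : ∀ X, Φ.ψ X ≠ 0) (q : Fin 3 → ℤ) :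
    Continuous fun X : Config (m + 1) =>
      cellFourierCoeff L (fun y => (fibrePsi Φ (Function.update X 0 y) : ℂ)) q := by
  have hG : Continuous fun p : Space × Config (m + 1) =>
      conj (cellWave L q p.1) * (fibrePsi Φ (Function.update p.2 0 p.1) : ℂ) :=
    (Complex.continuous_conj.comp ((contDiff_cellWave L q).continuous.comp continuous_fst)).mul
      (Complex.continuous_ofReal.comp ((continuous_fibrePsi hL Φ hΦ).comp continuous_update_zero))
  have h := continuous_parametric_setIntegral_of_isBounded (μ := volume) (isBounded_cell L)
    (measurableSet_cell L) hG
  have heq : (fun X : Config (m + 1) =>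
      cellFourierCoeff L (fun y => (fibrePsi Φ (Function.update X 0 y) : ℂ)) q) = fun X =>
        ((L ^ 3)⁻¹ : ℝ) • ∫ y in cell L, conj (cellWave L q y) * (fibrePsi Φ (Function.update X 0 y) : ℂ) :=
    funext fun X => cellFourierCoeff_eq_integral hL _ q
  rw [heq]
  exact h.const_smul ((L ^ 3)⁻¹ : ℝ)

/-- **Bath expectation of fibre Fourier modes = occupations**: for every lattice mode `q`,
`∫_{cell^N} W(X̂) |ĉ_q(ψ(·|X̂))|² dX = n_q(|Φ|)/N` (`n_q(|Φ|)` = `cellOccupation` of the plane wave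
`φ_q` in `X ↦ |Φ X|`). [folklore] -/
theorem lintegral_fibreW_mul_norm_sq_cellFourierCoeff (hL : 0 < L) (Φ : PeriodicTrialState (m + 1) L)
    (hΦ : ∀ X, Φ.ψ X ≠ 0) (q : Fin 3 → ℤ) :
    ∫⁻ X in cellN (m + 1) L, ENNReal.ofReal
        (fibreW Φ X * ‖cellFourierCoeff L (fun y => (fibrePsi Φ (Function.update X 0 y) : ℂ)) q‖ ^ 2) =
      cellOccupation (m + 1) L (planeWaveMode L q) (fun X => (‖Φ.ψ X‖ : ℂ)) / (m + 1 : ℝ≥0∞) := by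
  -- the right-hand side through slices
  rw [cellOccupation_succ, mul_comm, ENNReal.mul_div_cancel_right (by positivity) (by simp)]
  -- the left-hand side through slices
  have hmeas : Measurable fun X : Config (m + 1) => ENNReal.ofReal
      (fibreW Φ X * ‖cellFourierCoeff L (fun y => (fibrePsi Φ (Function.update X 0 y) : ℂ)) q‖ ^ 2) :=
    ((measurable_fibreW Φ).mul
      ((continuous_cellFourierCoeff_fibrePsi hL Φ hΦ q).measurable.norm.pow_const 2)).ennreal_ofReal
  rw [lintegral_cellN_succ L hmeas]
  refine setLIntegral_congr_fun (measurableSet_cellN m L) fun Y _ => ?_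
  -- on the fibre of `Y` everything is constant in the fibre variable
  have hupd : ∀ x y : Space, Function.update (Matrix.vecCons x Y) 0 y = Matrix.vecCons y Y :=
    fun x y => Fin.update_cons_zero (α := fun _ => Space) x Y y
  set w : ℝ := fibreW Φ (Matrix.vecCons 0 Y) with hw_def
  have hw : ∀ x, fibreW Φ (Matrix.vecCons x Y) = w := by
    intro x
    simp only [hw_def, fibreW, hupd]
  set ψY : Space → ℂ := fun y => (fibrePsi Φ (Matrix.vecCons y Y) : ℂ) with hψY
  have hF : ∀ x : Space, ENNReal.ofReal (fibreW Φ (Matrix.vecCons x Y) *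
      ‖cellFourierCoeff L (fun y => (fibrePsi Φ (Function.update (Matrix.vecCons x Y) 0 y) : ℂ)) q‖ ^ 2) =
        ENNReal.ofReal (w * ‖cellFourierCoeff L ψY q‖ ^ 2) := by
    intro x
    simp only [hupd, hw, hψY]
  simp_rw [hF]
  rw [setLIntegral_const, volume_cell, nnnorm_sq_integral_conj_planeWaveMode_mul hL]
  have hfun : (fun x => (‖Φ.ψ (Matrix.vecCons x Y)‖ : ℂ)) = fun x => (Real.sqrt w : ℂ) * ψY x := by
    funext x
    rw [hψY, norm_eq_sqrt_fibreW_mul hL Φ hΦ, hw, Complex.ofReal_mul]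
  rw [hfun, cellFourierCoeff_const_mul hL, coe_nnnorm_sq_eq_ofReal, norm_mul, mul_pow,
    Complex.norm_real, Real.norm_of_nonneg (Real.sqrt_nonneg _),
    Real.sq_sqrt (fibreW_nonneg Φ _), mul_comm]

end Summit.AtomisticToContinuum.BoseEinsteinCondensation.Cruxes.FibreConductance.ParsevalShellBootstrap

end
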